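import Summits.Ventures.GridStability.Lyapunov.StructurePreservingPolytopeRate
import Summits.Ventures.GridStability.Lyapunov.StructurePreservingPolytopeCusa
import HarnessLib

/-!
# GridStability/Lyapunov/PolytopeRateKit — «SP-RATE-POLYTOPE», the instance kit: per-edge test angles
# `σ* ± 8·arctan ρ` with RATIONAL `sin/cos` and a certified rational enclosure of the offset, so that an
# `EdgeRateCert` follows from ONE decidable check per ordered coupled pair

Cell `gridfusion` (LADDER-GRIDFUSION), seat gridfusion-lyap-1 (g8). `StructurePreservingPolytopeRate.lean` asks,
per coupled pair, for scalar inequalities at two test angles `ℓ ≤ σ* ≤ u` involving `sin`, `cos`,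
`branchEnergy` and the offsets `u − σ*`, `σ* − ℓ`. With half-angle-tangent equilibria (`sin σ*`, `cos σ*`
rational — model-2's `halfAngle`, model-1's circle points) the only transcendental quantity is the offset.
Choosing the offset as `Δ = 8·arctan ρ` (`ρ ∈ ℚ`, `0 ≤ ρ ≤ 39/100`, offsets up to ≈ 170°) makes
`sin Δ`, `cos Δ` rational (three angle doublings of `2ρ/(1+ρ²)`, `(1−ρ²)/(1+ρ²)`) and encloses `Δ` between
`dlo ρ = 12·sin(Δ/4)/(2 + cos(Δ/4))` (Cusa–Huygens at the quarter angle, lyap-1 g6's `three_mul_sin_le`)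
and `dhi ρ = 8ρ` (`x ≤ tan x`) — both within ≈ 2 % for offsets ≤ 115°. CONTENTS:
* `tsin/tcos/osin/ocos/dlo/dhi` (rational functions over any field; `_ratCast` lemmas) and the real
  facts `sin_eight_arctan`, `cos_eight_arctan`, `dlo_le_eight_arctan`, `eight_arctan_le_dhi`;
* `HiCheck sa ca ρ b c m k` — the conjunction of FIVE polynomial inequalities in
  `(sin σ*, cos σ*, ρ, b, c, m, k)` (range, confinement, slope, ratio, slope-at-equilibrium), decidable
  over `ℚ`;
* **`hi_endpoint_facts`** — `HiCheck` at `(sin a, cos a)` ⇒ the five `EdgeRateCert` facts at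
  `u = a + 8·arctan ρ`; **`lo_endpoint_facts`** — `HiCheck` at `(−sin a, cos a)` ⇒ the five facts at
  `ℓ = a − 8·arctan ρ` (mirror);
* **`EdgeRateCert.of_ratChecks`** — from rational tables `(b, sin σ*, cos σ*, ρ⁺, ρ⁻)` per coupled
  pair and ONE `HiCheck` per endpoint (an instance proves them by `decide`), the certificate for
  `ℓᵢⱼ = σ*ᵢⱼ − 8·arctan ρ⁻ᵢⱼ`, `uᵢⱼ = σ*ᵢⱼ + 8·arctan ρ⁺ᵢⱼ`.
Bookkeeping and elementary real analysis; no named fact; standard axioms. Exact-rational mirror of the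
check expressions: this seat's `tools/kitq.py` (HOME/lean/tools/lyap-1/sp-polyrate/).
-/

noncomputable section

open Set Real
open Summit.Ventures.GridStability.Models.StructurePreserving
open Summit.Ventures.GridStability.Models.StructurePreserving.Params
open Summit.Ventures.GridStability.Lyapunov.StructurePreserving

namespace Summit.Ventures.GridStability.Lyapunov.PolytopeSector

section Poly

variable {K : Type*} [Field K]

/-- `sin(2·arctan ρ) = 2ρ/(1 + ρ²)` as a rational function. [folklore] -/
def tsin (ρ : K) : K := 2 * ρ / (1 + ρ ^ 2)

/-- `cos(2·arctan ρ) = (1 − ρ²)/(1 + ρ²)` as a rational function. [folklore] -/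
def tcos (ρ : K) : K := (1 - ρ ^ 2) / (1 + ρ ^ 2)

/-- `sin(8·arctan ρ)` as a rational function (two more doublings). [folklore] -/
def osin (ρ : K) : K := 2 * (2 * tsin ρ * tcos ρ) * (tcos ρ ^ 2 - tsin ρ ^ 2)

/-- `cos(8·arctan ρ)` as a rational function. [folklore] -/
def ocos (ρ : K) : K := (tcos ρ ^ 2 - tsin ρ ^ 2) ^ 2 - (2 * tsin ρ * tcos ρ) ^ 2

/-- Cusa–Huygens lower enclosure of the offset: `dlo ρ = 12·sin(2·arctan ρ)/(2 + cos(2·arctan ρ))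
≤ 8·arctan ρ`. [folklore] -/
def dlo (ρ : K) : K := 12 * tsin ρ / (2 + tcos ρ)

/-- Tangent upper enclosure of the offset: `8·arctan ρ ≤ dhi ρ = 8ρ`. [folklore] -/
def dhi (ρ : K) : K := 8 * ρ

variable [LinearOrder K]

/-- **The endpoint check** for the test angle `a + 8·arctan ρ` of a branch with `sin a = sa`,
`cos a = ca`, coupling `b`, level `c`, slope `m`, ratio `k` — five polynomial inequalities:
(range) `0 ≤ ρ ≤ 39/100` and (`cos Δ ≥ 0` or `sin a ≤ sin Δ`), so the test angle is `≤ π`;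
(confinement) `c < b·(ca − cos u − max(dhi·sa, dlo·sa))`, a lower bound of `b·U(u)`;
(slope) `m·dhi ≤ sin u − sa`; (ratio) `k·(ca − cos u − min(dhi·sa, dlo·sa)) ≤ dlo·(sin u − sa)`;
(equilibrium slope) `m ≤ ca`; with `sin u = sa·ocos + ca·osin`, `cos u = ca·ocos − sa·osin`. Decidable
over `ℚ` (an `abbrev`, so that `decide` sees the conjunction). [folklore] -/
abbrev HiCheck (sa ca ρ b c m k : K) : Prop :=
  (0 ≤ ρ ∧ ρ ≤ 39 / 100) ∧ (0 ≤ ocos ρ ∨ sa ≤ osin ρ) ∧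
  c < b * (ca - (ca * ocos ρ - sa * osin ρ) - max (dhi ρ * sa) (dlo ρ * sa)) ∧
  m * dhi ρ ≤ (sa * ocos ρ + ca * osin ρ) - sa ∧
  k * (ca - (ca * ocos ρ - sa * osin ρ) - min (dhi ρ * sa) (dlo ρ * sa))
    ≤ dlo ρ * ((sa * ocos ρ + ca * osin ρ) - sa) ∧
  m ≤ ca

end Poly

/-! ### Casts `ℚ → ℝ` -/

/-- `tsin` commutes with the cast. [folklore] -/
theorem tsin_ratCast (q : ℚ) : ((tsin q : ℚ) : ℝ) = tsin (q : ℝ) := by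
  unfold tsin; push_cast; rfl

/-- `tcos` commutes with the cast. [folklore] -/
theorem tcos_ratCast (q : ℚ) : ((tcos q : ℚ) : ℝ) = tcos (q : ℝ) := by
  unfold tcos; push_cast; rfl

/-- `osin` commutes with the cast. [folklore] -/
theorem osin_ratCast (q : ℚ) : ((osin q : ℚ) : ℝ) = osin (q : ℝ) := by
  unfold osin; push_cast; rw [tsin_ratCast, tcos_ratCast]

/-- `ocos` commutes with the cast. [folklore] -/
theorem ocos_ratCast (q : ℚ) : ((ocos q : ℚ) : ℝ) = ocos (q : ℝ) := by
  unfold ocos; push_cast; rw [tsin_ratCast, tcos_ratCast]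

/-- `dlo` commutes with the cast. [folklore] -/
theorem dlo_ratCast (q : ℚ) : ((dlo q : ℚ) : ℝ) = dlo (q : ℝ) := by
  unfold dlo; push_cast; rw [tsin_ratCast, tcos_ratCast]

/-- `dhi` commutes with the cast. [folklore] -/
theorem dhi_ratCast (q : ℚ) : ((dhi q : ℚ) : ℝ) = dhi (q : ℝ) := by
  unfold dhi; push_cast; rfl

/-- **The endpoint check transfers from `ℚ` to `ℝ`.** [folklore] -/
theorem hiCheck_ratCast {sa ca ρ b c m k : ℚ} (h : HiCheck sa ca ρ b c m k) :
    HiCheck (sa : ℝ) (ca : ℝ) (ρ : ℝ) (b : ℝ) (c : ℝ) (m : ℝ) (k : ℝ) := by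
  obtain ⟨⟨h1, h2⟩, h3, h4, h5, h6, h7⟩ := h
  have h1' := (Rat.cast_le (K := ℝ)).2 h1
  have h2' := (Rat.cast_le (K := ℝ)).2 h2
  have h7' := (Rat.cast_le (K := ℝ)).2 h7
  push_cast at h1' h2' h7'
  refine ⟨⟨h1', h2'⟩, ?_, ?_, ?_, ?_, h7'⟩
  · rcases h3 with h3 | h3
    · left
      have := (Rat.cast_le (K := ℝ)).2 h3
      push_cast at this
      rwa [ocos_ratCast] at this
    · right
      have := (Rat.cast_le (K := ℝ)).2 h3
      rwa [osin_ratCast] at this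
  · have := (Rat.cast_lt (K := ℝ)).2 h4
    push_cast at this
    rwa [ocos_ratCast, osin_ratCast, dhi_ratCast, dlo_ratCast] at this
  · have := (Rat.cast_le (K := ℝ)).2 h5
    push_cast at this
    rwa [ocos_ratCast, osin_ratCast, dhi_ratCast] at this
  · have := (Rat.cast_le (K := ℝ)).2 h6
    push_cast at this
    rwa [ocos_ratCast, osin_ratCast, dhi_ratCast, dlo_ratCast] at this

/-! ### The offset `8·arctan ρ`: rational `sin`/`cos`, certified enclosure -/

/-- `sin(8·arctan ρ) = osin ρ`. [folklore] -/
theorem sin_eight_arctan (ρ : ℝ) : Real.sin (8 * Real.arctan ρ) = osin ρ := by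
  set ψ := 2 * Real.arctan ρ with hψ
  have hs : Real.sin ψ = tsin ρ := sin_two_mul_arctan ρ
  have hc : Real.cos ψ = tcos ρ := cos_two_mul_arctan ρ
  have hs2 : Real.sin (2 * ψ) = 2 * tsin ρ * tcos ρ := by rw [Real.sin_two_mul, hs, hc]
  have hc2 : Real.cos (2 * ψ) = tcos ρ ^ 2 - tsin ρ ^ 2 := by
    rw [Real.cos_two_mul, ← hc, ← hs]
    nlinarith [Real.sin_sq_add_cos_sq ψ]
  have h8 : 8 * Real.arctan ρ = 2 * (2 * ψ) := by rw [hψ]; ring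
  rw [h8, Real.sin_two_mul, hs2, hc2]
  rfl

/-- `cos(8·arctan ρ) = ocos ρ`. [folklore] -/
theorem cos_eight_arctan (ρ : ℝ) : Real.cos (8 * Real.arctan ρ) = ocos ρ := by
  set ψ := 2 * Real.arctan ρ with hψ
  have hs : Real.sin ψ = tsin ρ := sin_two_mul_arctan ρ
  have hc : Real.cos ψ = tcos ρ := cos_two_mul_arctan ρ
  have hs2 : Real.sin (2 * ψ) = 2 * tsin ρ * tcos ρ := by rw [Real.sin_two_mul, hs, hc]
  have hc2 : Real.cos (2 * ψ) = tcos ρ ^ 2 - tsin ρ ^ 2 := by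
    rw [Real.cos_two_mul, ← hc, ← hs]
    nlinarith [Real.sin_sq_add_cos_sq ψ]
  have h8 : 8 * Real.arctan ρ = 2 * (2 * ψ) := by rw [hψ]; ring
  have hc4 : Real.cos (2 * (2 * ψ)) = Real.cos (2 * ψ) ^ 2 - Real.sin (2 * ψ) ^ 2 := by
    rw [Real.cos_two_mul]
    nlinarith [Real.sin_sq_add_cos_sq (2 * ψ)]
  rw [h8, hc4, hs2, hc2]
  rfl

/-- **Upper enclosure**: `8·arctan ρ ≤ 8ρ` for `ρ ≥ 0` (`x ≤ tan x` on `[0, π/2)`). [folklore] -/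
theorem eight_arctan_le_dhi {ρ : ℝ} (hρ : 0 ≤ ρ) : 8 * Real.arctan ρ ≤ dhi ρ := by
  have h := Real.le_tan (Real.arctan_nonneg.2 hρ) (Real.arctan_lt_pi_div_two ρ)
  rw [Real.tan_arctan] at h
  unfold dhi
  linarith

/-- **Lower enclosure** (Cusa–Huygens at the quarter angle `ψ = 2·arctan ρ ∈ [0, π/2]`, `ρ ≤ 1`):
`dlo ρ = 12 sin ψ/(2 + cos ψ) ≤ 4ψ = 8·arctan ρ`. [folklore] -/
theorem dlo_le_eight_arctan {ρ : ℝ} (hρ0 : 0 ≤ ρ) (hρ1 : ρ ≤ 1) : dlo ρ ≤ 8 * Real.arctan ρ := by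
  set ψ := 2 * Real.arctan ρ with hψ
  have hψ0 : 0 ≤ ψ := by
    have := Real.arctan_nonneg.2 hρ0
    rw [hψ]; linarith
  have hψ1 : ψ ≤ π / 2 := by
    have h1 : Real.arctan ρ ≤ Real.arctan 1 := Real.arctan_le_arctan_iff.2 hρ1
    rw [Real.arctan_one] at h1
    rw [hψ]; linarith
  have hcusa := three_mul_sin_le hψ0 hψ1
  have hden : 0 < 2 + Real.cos ψ := by linarith [Real.neg_one_le_cos ψ]
  have hs : Real.sin ψ = tsin ρ := sin_two_mul_arctan ρ
  have hc : Real.cos ψ = tcos ρ := cos_two_mul_arctan ρ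
  unfold dlo
  rw [← hs, ← hc, div_le_iff₀ hden]
  have h8 : 8 * Real.arctan ρ = 4 * ψ := by rw [hψ]; ring
  rw [h8]
  nlinarith

/-- The offset is nonnegative for `ρ ≥ 0`. [folklore] -/
theorem eight_arctan_nonneg {ρ : ℝ} (hρ : 0 ≤ ρ) : 0 ≤ 8 * Real.arctan ρ := by
  have := Real.arctan_nonneg.2 hρ
  linarith

/-- The offset is `< π` for `0 ≤ ρ ≤ 39/100` (`8ρ ≤ 3.12 < π`). [folklore] -/
theorem eight_arctan_lt_pi {ρ : ℝ} (hρ0 : 0 ≤ ρ) (hρ1 : ρ ≤ 39 / 100) : 8 * Real.arctan ρ < π := by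
  have h := eight_arctan_le_dhi hρ0
  unfold dhi at h
  linarith [Real.pi_gt_d2]

/-! ### The endpoint facts from the check -/

/-- **The five certificate facts at the upper test angle `u = a + 8·arctan ρ` from `HiCheck`.** For
`sin a = sa`, `cos a = ca`, `|a| ≤ π/2`, `0 ≤ b`, `0 ≤ m`, `0 ≤ k` and `HiCheck sa ca ρ b c m k`:
`a ≤ u ≤ π`, `c < b·U(u)`, `m(u − a) ≤ sin u − sin a`, `k·U(u) ≤ (u − a)(sin u − sin a)`
(`U = branchEnergy · a`). Proof: `sin u`, `cos u` by the addition formulas with `sin_eight_arctan`,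
`cos_eight_arctan`; `U(u) = ca − cos u − Δ·sa` with `Δ ∈ [dlo, dhi]`; `u ≤ π` from `cos Δ ≥ 0` (then
`Δ ≤ π/2`) or from `sin a ≤ sin Δ = sin(π − Δ)` (then `a ≤ π − Δ` by monotonicity of `sin` on
`[−π/2, π/2]`). [folklore] -/
theorem hi_endpoint_facts {a sa ca ρ b c m k : ℝ} (hsa : Real.sin a = sa) (hca : Real.cos a = ca)
    (ha : |a| ≤ π / 2) (hb : 0 ≤ b) (hm : 0 ≤ m) (hk : 0 ≤ k) (hchk : HiCheck sa ca ρ b c m k) :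
    a ≤ a + 8 * Real.arctan ρ ∧ a + 8 * Real.arctan ρ ≤ π ∧
    c < b * branchEnergy (a + 8 * Real.arctan ρ) a ∧
    m * ((a + 8 * Real.arctan ρ) - a) ≤ Real.sin (a + 8 * Real.arctan ρ) - Real.sin a ∧
    k * branchEnergy (a + 8 * Real.arctan ρ) a
      ≤ ((a + 8 * Real.arctan ρ) - a) * (Real.sin (a + 8 * Real.arctan ρ) - Real.sin a) := by
  obtain ⟨⟨hρ0, hρ1⟩, hrange, hC1, hS, hR, -⟩ := hchk
  obtain ⟨ha1, ha2⟩ := abs_le.1 ha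
  set Δ := 8 * Real.arctan ρ with hΔ
  have hΔ0 : 0 ≤ Δ := eight_arctan_nonneg hρ0
  have hΔlo : dlo ρ ≤ Δ := dlo_le_eight_arctan hρ0 (by linarith)
  have hΔhi : Δ ≤ dhi ρ := eight_arctan_le_dhi hρ0
  have hΔπ : Δ < π := eight_arctan_lt_pi hρ0 hρ1
  have hsinΔ : Real.sin Δ = osin ρ := sin_eight_arctan ρ
  have hcosΔ : Real.cos Δ = ocos ρ := cos_eight_arctan ρ
  have hsinu : Real.sin (a + Δ) = sa * ocos ρ + ca * osin ρ := by
    rw [Real.sin_add, hsa, hca, hsinΔ, hcosΔ]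
  have hcosu : Real.cos (a + Δ) = ca * ocos ρ - sa * osin ρ := by
    rw [Real.cos_add, hsa, hca, hsinΔ, hcosΔ]
  have hU : branchEnergy (a + Δ) a = ca - (ca * ocos ρ - sa * osin ρ) - Δ * sa := by
    simp only [branchEnergy, hcosu, hca, hsa]
    ring
  -- `Δ·sa` between `min` and `max` of `dhi·sa`, `dlo·sa`
  have hΔsa_le : Δ * sa ≤ max (dhi ρ * sa) (dlo ρ * sa) := by
    rcases le_or_gt 0 sa with h | h
    · exact (mul_le_mul_of_nonneg_right hΔhi h).trans (le_max_left _ _)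
    · exact (mul_le_mul_of_nonpos_right hΔlo h.le).trans (le_max_right _ _)
  have hΔsa_ge : min (dhi ρ * sa) (dlo ρ * sa) ≤ Δ * sa := by
    rcases le_or_gt 0 sa with h | h
    · exact (min_le_right _ _).trans (mul_le_mul_of_nonneg_right hΔlo h)
    · exact (min_le_left _ _).trans (mul_le_mul_of_nonpos_right hΔhi h.le)
  have hsub : a + Δ - a = Δ := by ring
  refine ⟨by linarith, ?_, ?_, ?_, ?_⟩
  · -- `a + Δ ≤ π`
    have hcase : Δ ≤ π / 2 ∨ π / 2 < Δ := le_or_gt Δ (π / 2)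
    rcases hcase with hle | hgt
    · linarith
    · rcases hrange with h | h
      · exfalso
        have : Real.cos Δ < 0 := Real.cos_neg_of_pi_div_two_lt_of_lt hgt (by linarith)
        rw [hcosΔ] at this
        linarith
      · -- `sin a ≤ sin Δ = sin (π − Δ)` with both angles in `[−π/2, π/2]`
        have hs : Real.sin a ≤ Real.sin (π - Δ) := by rw [Real.sin_pi_sub, hsinΔ, hsa]; exact h
        have hmem1 : a ∈ Icc (-(π / 2)) (π / 2) := ⟨ha1, ha2⟩
        have hmem2 : π - Δ ∈ Icc (-(π / 2)) (π / 2) := ⟨by linarith, by linarith⟩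
        have := (Real.strictMonoOn_sin.le_iff_le hmem1 hmem2).1 hs
        linarith
  · -- confinement
    rw [hU]
    have hlow : ca - (ca * ocos ρ - sa * osin ρ) - max (dhi ρ * sa) (dlo ρ * sa)
        ≤ ca - (ca * ocos ρ - sa * osin ρ) - Δ * sa := by linarith
    exact hC1.trans_le (mul_le_mul_of_nonneg_left hlow hb)
  · -- slope
    rw [hsub, hsinu, hsa]
    exact (mul_le_mul_of_nonneg_left hΔhi hm).trans hS
  · -- ratio
    rw [hsub, hU, hsinu, hsa]
    have hpos : 0 ≤ sa * ocos ρ + ca * osin ρ - sa := by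
      have : 0 ≤ m * dhi ρ := mul_nonneg hm (by unfold dhi; linarith)
      linarith
    have hupper : ca - (ca * ocos ρ - sa * osin ρ) - Δ * sa
        ≤ ca - (ca * ocos ρ - sa * osin ρ) - min (dhi ρ * sa) (dlo ρ * sa) := by linarith
    calc k * (ca - (ca * ocos ρ - sa * osin ρ) - Δ * sa)
        ≤ k * (ca - (ca * ocos ρ - sa * osin ρ) - min (dhi ρ * sa) (dlo ρ * sa)) :=
          mul_le_mul_of_nonneg_left hupper hk
      _ ≤ dlo ρ * (sa * ocos ρ + ca * osin ρ - sa) := hR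
      _ ≤ Δ * (sa * ocos ρ + ca * osin ρ - sa) := mul_le_mul_of_nonneg_right hΔlo hpos

/-- **The five certificate facts at the lower test angle `ℓ = a − 8·arctan ρ` from the mirrored check
`HiCheck (−sa) ca ρ b c m k`** (the branch read backwards: `(y, a) ↦ (−y, −a)` preserves `U`, the slope
and the ratio products): `−π ≤ ℓ ≤ a`, `c < b·U(ℓ)`, `m(a − ℓ) ≤ sin a − sin ℓ`,
`k·U(ℓ) ≤ (ℓ − a)(sin ℓ − sin a)`. [folklore] -/
theorem lo_endpoint_facts {a sa ca ρ b c m k : ℝ} (hsa : Real.sin a = sa) (hca : Real.cos a = ca)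
    (ha : |a| ≤ π / 2) (hb : 0 ≤ b) (hm : 0 ≤ m) (hk : 0 ≤ k) (hchk : HiCheck (-sa) ca ρ b c m k) :
    -π ≤ a - 8 * Real.arctan ρ ∧ a - 8 * Real.arctan ρ ≤ a ∧
    c < b * branchEnergy (a - 8 * Real.arctan ρ) a ∧
    m * (a - (a - 8 * Real.arctan ρ)) ≤ Real.sin a - Real.sin (a - 8 * Real.arctan ρ) ∧
    k * branchEnergy (a - 8 * Real.arctan ρ) a
      ≤ ((a - 8 * Real.arctan ρ) - a) * (Real.sin (a - 8 * Real.arctan ρ) - Real.sin a) := by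
  have hsa' : Real.sin (-a) = -sa := by rw [Real.sin_neg, hsa]
  have hca' : Real.cos (-a) = ca := by rw [Real.cos_neg, hca]
  have ha' : |(-a)| ≤ π / 2 := by rwa [abs_neg]
  obtain ⟨h1, h2, h3, h4, h5⟩ := hi_endpoint_facts hsa' hca' ha' hb hm hk hchk
  have e : -a + 8 * Real.arctan ρ = -(a - 8 * Real.arctan ρ) := by ring
  rw [e] at h2 h3 h4 h5
  rw [branchEnergy_neg_neg] at h3 h5
  rw [Real.sin_neg, Real.sin_neg] at h4 h5
  refine ⟨by linarith, by linarith, h3, by linarith, ?_⟩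
  have e2 : (-(a - 8 * Real.arctan ρ) - -a) * (-Real.sin (a - 8 * Real.arctan ρ) - -Real.sin a)
      = ((a - 8 * Real.arctan ρ) - a) * (Real.sin (a - 8 * Real.arctan ρ) - Real.sin a) := by ring
  rwa [e2] at h5

/-! ### The certificate from rational tables -/

variable {n : ℕ}

/-- **`EdgeRateCert` from rational tables and one check per endpoint.** DATA: structure-preserving `p`
with `b ≥ 0`, an equilibrium `δ₀` with coupled `|σ*ᵢⱼ| ≤ π/2`, rational tables `bQ` (the couplings on
coupled pairs), `saQ, caQ` (`sin σ*ᵢⱼ`, `cos σ*ᵢⱼ` — exact for half-angle / circle-point data), offsets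
`ρhi, ρlo`, and rationals `c`, `0 ≤ m`, `0 ≤ k ≤ 1` such that `HiCheck (saQ i j) …(ρhi i j)…` and
`HiCheck (−saQ i j) …(ρlo i j)…` hold on every coupled pair. CLAIM: the per-edge certificate of
`StructurePreservingPolytopeRate.lean` holds with test angles `σ*ᵢⱼ ∓/± 8·arctan ρ`. [folklore] -/
theorem edgeRateCert_of_ratChecks {p : Params n} {δ₀ : Fin n → ℝ} (hb : ∀ i j, 0 ≤ p.b i j)
    (h0 : ∀ i j, p.b i j ≠ 0 → |δ₀ i - δ₀ j| ≤ π / 2)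
    (bQ saQ caQ ρhi ρlo : Fin n → Fin n → ℚ) (c m k : ℚ) (hm : 0 ≤ m) (hk0 : 0 ≤ k) (hk1 : k ≤ 1)
    (hbQ : ∀ i j, p.b i j ≠ 0 → p.b i j = bQ i j)
    (hsa : ∀ i j, p.b i j ≠ 0 → Real.sin (δ₀ i - δ₀ j) = saQ i j)
    (hca : ∀ i j, p.b i j ≠ 0 → Real.cos (δ₀ i - δ₀ j) = caQ i j)
    (hhi : ∀ i j, p.b i j ≠ 0 → HiCheck (saQ i j) (caQ i j) (ρhi i j) (bQ i j) c m k)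
    (hlo : ∀ i j, p.b i j ≠ 0 → HiCheck (-saQ i j) (caQ i j) (ρlo i j) (bQ i j) c m k) :
    EdgeRateCert p δ₀ (c : ℝ) (m : ℝ) (k : ℝ)
      (fun i j => (δ₀ i - δ₀ j) - 8 * Real.arctan (ρlo i j : ℝ))
      (fun i j => (δ₀ i - δ₀ j) + 8 * Real.arctan (ρhi i j : ℝ)) := by
  have hmR : (0 : ℝ) ≤ (m : ℝ) := by exact_mod_cast hm
  have hkR : (0 : ℝ) ≤ (k : ℝ) := by exact_mod_cast hk0
  have HI : ∀ i j, p.b i j ≠ 0 →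
      (δ₀ i - δ₀ j) ≤ (δ₀ i - δ₀ j) + 8 * Real.arctan (ρhi i j : ℝ) ∧
      (δ₀ i - δ₀ j) + 8 * Real.arctan (ρhi i j : ℝ) ≤ π ∧
      (c : ℝ) < p.b i j * branchEnergy ((δ₀ i - δ₀ j) + 8 * Real.arctan (ρhi i j : ℝ)) (δ₀ i - δ₀ j) ∧
      (m : ℝ) * (((δ₀ i - δ₀ j) + 8 * Real.arctan (ρhi i j : ℝ)) - (δ₀ i - δ₀ j))
        ≤ Real.sin ((δ₀ i - δ₀ j) + 8 * Real.arctan (ρhi i j : ℝ)) - Real.sin (δ₀ i - δ₀ j) ∧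
      (k : ℝ) * branchEnergy ((δ₀ i - δ₀ j) + 8 * Real.arctan (ρhi i j : ℝ)) (δ₀ i - δ₀ j)
        ≤ (((δ₀ i - δ₀ j) + 8 * Real.arctan (ρhi i j : ℝ)) - (δ₀ i - δ₀ j))
          * (Real.sin ((δ₀ i - δ₀ j) + 8 * Real.arctan (ρhi i j : ℝ)) - Real.sin (δ₀ i - δ₀ j)) := by
    intro i j hij
    have h := hi_endpoint_facts (hsa i j hij) (hca i j hij) (h0 i j hij)
      (show (0 : ℝ) ≤ (bQ i j : ℝ) by rw [← hbQ i j hij]; exact hb i j) hmR hkR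
      (hiCheck_ratCast (hhi i j hij))
    rw [← hbQ i j hij] at h
    exact h
  have LO : ∀ i j, p.b i j ≠ 0 →
      -π ≤ (δ₀ i - δ₀ j) - 8 * Real.arctan (ρlo i j : ℝ) ∧
      (δ₀ i - δ₀ j) - 8 * Real.arctan (ρlo i j : ℝ) ≤ (δ₀ i - δ₀ j) ∧
      (c : ℝ) < p.b i j * branchEnergy ((δ₀ i - δ₀ j) - 8 * Real.arctan (ρlo i j : ℝ)) (δ₀ i - δ₀ j) ∧
      (m : ℝ) * ((δ₀ i - δ₀ j) - ((δ₀ i - δ₀ j) - 8 * Real.arctan (ρlo i j : ℝ)))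
        ≤ Real.sin (δ₀ i - δ₀ j) - Real.sin ((δ₀ i - δ₀ j) - 8 * Real.arctan (ρlo i j : ℝ)) ∧
      (k : ℝ) * branchEnergy ((δ₀ i - δ₀ j) - 8 * Real.arctan (ρlo i j : ℝ)) (δ₀ i - δ₀ j)
        ≤ (((δ₀ i - δ₀ j) - 8 * Real.arctan (ρlo i j : ℝ)) - (δ₀ i - δ₀ j))
          * (Real.sin ((δ₀ i - δ₀ j) - 8 * Real.arctan (ρlo i j : ℝ)) - Real.sin (δ₀ i - δ₀ j)) := by
    intro i j hij
    have hchk := hiCheck_ratCast (hlo i j hij)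
    push_cast at hchk
    have h := lo_endpoint_facts (hsa i j hij) (hca i j hij) (h0 i j hij)
      (show (0 : ℝ) ≤ (bQ i j : ℝ) by rw [← hbQ i j hij]; exact hb i j) hmR hkR hchk
    rw [← hbQ i j hij] at h
    exact h
  exact
    { neg_pi_le := fun i j hij => (LO i j hij).1
      lo_le := fun i j hij => (LO i j hij).2.1
      le_hi := fun i j hij => (HI i j hij).1
      le_pi := fun i j hij => (HI i j hij).2.1
      level_lo := fun i j hij => (LO i j hij).2.2.1
      level_hi := fun i j hij => (HI i j hij).2.2.1
      slope_le_cos := fun i j hij => by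
        rw [hca i j hij]
        exact_mod_cast (hhi i j hij).2.2.2.2.2
      slope_lo := fun i j hij => (LO i j hij).2.2.2.1
      slope_hi := fun i j hij => (HI i j hij).2.2.2.1
      ratio_le_one := by exact_mod_cast hk1
      ratio_lo := fun i j hij => (LO i j hij).2.2.2.2
      ratio_hi := fun i j hij => (HI i j hij).2.2.2.2 }

end Summit.Ventures.GridStability.Lyapunov.PolytopeSector

end
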